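import Mathlib
import HarnessLib
import Literature.Combinatorics.Additive.Pollard
import Literature.Combinatorics.Additive.Kneser
import Literature.Combinatorics.Additive.GrynkiewiczPollardRep
import Literature.Combinatorics.Additive.GrynkiewiczPollardKneserTools
import Literature.Combinatorics.Additive.GrynkiewiczPollardStepOne
import Literature.Combinatorics.Additive.GrynkiewiczPollardStepTwo

/-!
# Grynkiewicz's extension of Pollard's theorem — port, part V: the maximal translate, coset separation, energy

Topic: `Literature/Combinatorics/Additive`.  Fifth file of the port of [Gry10] Theorem 1.1 / 1.2: the
set-up between STEP 2 and STEP 3 of [Gry10] §2.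

* the maximal Dyson translate: if `|stab(A)| < |B|` there is `x` with `1 ≤ |A ∩ (x + B)| < |B|` maximal
  among the translates not contained in `A` (`exists_max_translate`), and the set
  `T = {z : z + B ⊆ A}` with `T + B ⊆ A`;
* coset separation: if `B` lies in one coset of a finite subgroup `K` and `A = A₁ ⊔ A₂` with `A₁` the part
  of `A` in one `K`-coset, then `r_{A,B}` and `N_t` split (`NS_eq_add_of_separated`), whence the
  "coset trap" `goal_of_subset_coset` ([Gry10] §2 Case 3.2, second paragraph);
* the additive-energy identities behind [Gry10] Lemma 2.1: `Σ_{w ∈ A+B} r_{A,B}(w)² = Σ_{z ∈ A−B} |A ∩ (z+B)|²`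
  and `Σ_{z ∈ A−B} |A ∩ (z + B)| = |A||B|`.

## References
* D. J. Grynkiewicz, *On extending Pollard's theorem for t-representable sums*, Israel J. Math. 177 (2010)
  413–439 (arXiv:0803.2601), §2 (Lemma 2.1, Step 3) [cite: Grynkiewicz2010, Lemma 2.1].
-/

namespace Literature.Combinatorics.Additive

namespace Grynkiewicz

open Finset Pollard
open scoped Pointwise

variable {G : Type*} [AddCommGroup G] [DecidableEq G]

/-! ### Translates of `B` inside `A` -/

section Translate

variable {A B : Finset G}

/-- `a ∈ A ∩ (z + B)` unpacked. [cite: Grynkiewicz2010, §2 Step 3] -/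
theorem mem_inter_vadd_iff {z a : G} : a ∈ A ∩ (z +ᵥ B) ↔ a ∈ A ∧ a - z ∈ B := by
  rw [mem_inter, mem_vadd_finset]
  constructor
  · rintro ⟨ha, b, hb, rfl⟩; exact ⟨ha, by simpa using hb⟩
  · rintro ⟨ha, hb⟩; exact ⟨ha, a - z, hb, by simp [vadd_eq_add]⟩

/-- If `A ∩ (z + B)` is nonempty then `z ∈ A − B`. [cite: Grynkiewicz2010, §2 Step 3] -/
theorem mem_sub_of_inter_vadd_nonempty {z : G} (h : (A ∩ (z +ᵥ B)).Nonempty) : z ∈ A - B := by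
  obtain ⟨a, ha⟩ := h
  rw [mem_inter_vadd_iff] at ha
  exact mem_sub.2 ⟨a, ha.1, a - z, ha.2, by abel⟩

/-- `|A ∩ (z + B)| ≤ |B|`. [cite: Grynkiewicz2010, §2 Step 3] -/
theorem card_inter_vadd_le (z : G) : (A ∩ (z +ᵥ B)).card ≤ B.card :=
  (card_le_card inter_subset_right).trans (card_vadd_finset z B).le

/-- If `z + B ⊆ A` then `|A ∩ (z + B)| = |B|`. [cite: Grynkiewicz2010, §2 Step 3] -/
theorem card_inter_vadd_of_subset {z : G} (h : z +ᵥ B ⊆ A) : (A ∩ (z +ᵥ B)).card = B.card := by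
  rw [inter_eq_right.2 h, card_vadd_finset]

/-- If `|A ∩ (z + B)| = |B|` then `z + B ⊆ A`. [cite: Grynkiewicz2010, §2 Step 3] -/
theorem vadd_subset_of_card_inter_eq {z : G} (h : (A ∩ (z +ᵥ B)).card = B.card) : z +ᵥ B ⊆ A := by
  have : A ∩ (z +ᵥ B) = z +ᵥ B :=
    eq_of_subset_of_card_le inter_subset_right (by rw [h, card_vadd_finset])
  rw [← this]; exact inter_subset_left

/-- **The maximal translate** ([Gry10] §2, before Step 3).  If `A, B` are nonempty and `|stab(A)| < |B|`,
there is `x` with `1 ≤ |A ∩ (x + B)| < |B|` such that every translate `z + B` is either contained in `A`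
or meets `A` in at most `|A ∩ (x + B)|` points. [cite: Grynkiewicz2010, §2 Step 3] -/
theorem exists_max_translate (hA : A.Nonempty) (hB : B.Nonempty) (hstab : A.addStab.card < B.card) :
    ∃ x : G, 1 ≤ (A ∩ (x +ᵥ B)).card ∧ (A ∩ (x +ᵥ B)).card < B.card ∧
      ∀ z : G, (A ∩ (z +ᵥ B)).card ≤ (A ∩ (x +ᵥ B)).card ∨ z +ᵥ B ⊆ A := by
  set Z' := (A - B).filter (fun z => ¬ z +ᵥ B ⊆ A) with hZ'
  have hZ'ne : Z'.Nonempty := by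
    by_contra hcon
    rw [not_nonempty_iff_eq_empty, hZ', filter_eq_empty_iff] at hcon
    obtain ⟨b₀, hb₀⟩ := hB
    have hsub : ∀ b ∈ B, b - b₀ ∈ A.addStab := by
      intro b hb
      refine mem_addStab_of_forall_add_mem hA fun a ha => ?_
      have hz : a - b₀ ∈ A - B := sub_mem_sub ha hb₀
      have h2 := not_not.1 (hcon hz)
      have : b - b₀ + a = (a - b₀) +ᵥ b := by rw [vadd_eq_add]; abel
      rw [this]
      exact h2 (mem_vadd_finset.2 ⟨b, hb, rfl⟩)
    exact absurd (card_le_card_addStab_of_sub_mem hsub) (not_le.2 hstab)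
  obtain ⟨x, hx, hmax⟩ := exists_max_image Z' (fun z => (A ∩ (z +ᵥ B)).card) hZ'ne
  rw [hZ', mem_filter] at hx
  refine ⟨x, ?_, ?_, fun z => ?_⟩
  · obtain ⟨a, ha, b, hb, rfl⟩ := mem_sub.1 hx.1
    rw [Nat.one_le_iff_ne_zero, Ne, card_eq_zero, ← Ne, ← nonempty_iff_ne_empty]
    exact ⟨a, mem_inter_vadd_iff.2 ⟨ha, by simpa using hb⟩⟩
  · refine lt_of_le_of_ne (card_inter_vadd_le x) fun h => hx.2 (vadd_subset_of_card_inter_eq h)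
  · by_cases h : z +ᵥ B ⊆ A
    · exact Or.inr h
    · left
      by_cases hz : (A ∩ (z +ᵥ B)).Nonempty
      · exact hmax z (mem_filter.2 ⟨mem_sub_of_inter_vadd_nonempty hz, h⟩)
      · rw [not_nonempty_iff_eq_empty] at hz
        rw [hz, card_empty]; exact Nat.zero_le _

/-- The translates contained in `A`: `T = {z ∈ A − B : z + B ⊆ A}`; membership. [cite: Grynkiewicz2010, §2 Step 3] -/
theorem mem_translates_iff (hB : B.Nonempty) {z : G} :
    z ∈ (A - B).filter (fun z => z +ᵥ B ⊆ A) ↔ z +ᵥ B ⊆ A := by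
  rw [mem_filter, and_iff_right_iff_imp]
  intro h
  obtain ⟨b, hb⟩ := hB
  exact mem_sub.2 ⟨z + b, h (mem_vadd_finset.2 ⟨b, hb, rfl⟩), b, hb, by abel⟩

/-- `T + B ⊆ A`. [cite: Grynkiewicz2010, §2 Step 3] -/
theorem translates_add_subset : (A - B).filter (fun z => z +ᵥ B ⊆ A) + B ⊆ A := by
  intro w hw
  obtain ⟨z, hz, b, hb, rfl⟩ := mem_add.1 hw
  exact (mem_filter.1 hz).2 (mem_vadd_finset.2 ⟨b, hb, rfl⟩)

/-- `|T| ≤ |A|`. [cite: Grynkiewicz2010, §2 Step 3] -/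
theorem card_translates_le (hB : B.Nonempty) : ((A - B).filter (fun z => z +ᵥ B ⊆ A)).card ≤ A.card := by
  obtain ⟨b, hb⟩ := hB
  have hinj : Set.InjOn (fun z => z + b) ↑((A - B).filter (fun z => z +ᵥ B ⊆ A)) :=
    fun z _ z' _ (e : z + b = z' + b) => add_right_cancel e
  rw [← card_image_of_injOn hinj]
  exact card_le_card fun w hw => by
    obtain ⟨z, hz, rfl⟩ := mem_image.1 hw
    exact (mem_filter.1 hz).2 (mem_vadd_finset.2 ⟨b, hb, rfl⟩)

end Translate

/-! ### Coset separation and the coset trap -/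

section Separation

variable {t c : ℕ} {A B : Finset G}

/-- If `A = A₁ ∪ A₂` disjointly and the sumsets `A₁ + B`, `A₂ + B` are disjoint, then `N_t` is additive.
[cite: Grynkiewicz2010, §2 Case 3.2] -/
theorem NS_union_of_separated {A₁ A₂ : Finset G} (hd : Disjoint A₁ A₂) (hs : Disjoint (A₁ + B) (A₂ + B)) :
    NS t (A₁ ∪ A₂) B = NS t A₁ B + NS t A₂ B := by
  have h1 : ∀ w ∈ A₁ + B, rep A₂ B w = 0 := fun w hw =>
    rep_eq_zero_of_not_mem (disjoint_left.1 hs hw)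
  have h2 : ∀ w ∈ A₂ + B, rep A₁ B w = 0 := fun w hw =>
    rep_eq_zero_of_not_mem (disjoint_right.1 hs hw)
  unfold NS
  rw [union_add, sum_union hs]
  congr 1
  · exact sum_congr rfl fun w hw => by rw [rep_union_left hd, h1 w hw, add_zero]
  · exact sum_congr rfl fun w hw => by rw [rep_union_left hd, h2 w hw, zero_add]

/-- Symmetric form of `card_filter_add_not_mem_ge_left`: for a Kneser-tight pair `A′, B′` and
`b ∉ B′ + H`, at least `|H| − ρ_{A′}` elements `a′ ∈ A′` have `a′ + b ∉ A′ + B′`. [cite: Grynkiewicz2010, §2 Step 1] -/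
theorem card_filter_add_not_mem_ge_right {A' B' : Finset G} (hA' : A'.Nonempty) (hB' : B'.Nonempty)
    (htight : (A' + B').card + (A' + B').addStab.card =
      (A' + (A' + B').addStab).card + (B' + (A' + B').addStab).card)
    {b : G} (hb : b ∉ B' + (A' + B').addStab) :
    (A' + B').addStab.card ≤ (A'.filter (fun a => a + b ∉ A' + B')).card +
      ((A' + (A' + B').addStab).card - A'.card) := by
  have e : B' + A' = A' + B' := add_comm B' A'
  have htight' : (B' + A').card + (B' + A').addStab.card =
      (B' + (B' + A').addStab).card + (A' + (B' + A').addStab).card := by rw [e]; omega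
  have hb' : b ∉ B' + (B' + A').addStab := by rw [e]; exact hb
  have h := card_filter_add_not_mem_ge_left hB' hA' htight' hb'
  rw [e] at h
  have hf : A'.filter (fun a => b + a ∉ A' + B') = A'.filter (fun a => a + b ∉ A' + B') :=
    filter_congr fun a _ => by rw [add_comm b a]
  rw [hf] at h
  exact h

/-- One piece of a separated pair: if `A₁ ⊆ A` has `|A₁| ≥ t`, `N_t(A₁,B) < N_t(A,B)`, and the sums in
`A₁ + B` have the same representations in `A + B` as in `A₁ + B`, then either `Goal t c A B` (an unpopular
row or column, STEP 2), or the Pollard bound holds for `(A₁, B)`, or every sum of `A₁ + B` is `t`-popular.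
[cite: Grynkiewicz2010, §2 Case 3.2] -/
theorem goal_or_of_piece (ht : 1 ≤ t) (hc : t * t ≤ c) (ih : IH t c A B) (hA : t + 1 ≤ A.card)
    (hB : t + 1 ≤ B.card) {A₁ : Finset G} (hA₁A : A₁ ⊆ A) (hA₁t : t ≤ A₁.card)
    (hNS : NS t A₁ B < NS t A B) (hsep : ∀ w ∈ A₁ + B, rep A B w = rep A₁ B w) :
    Goal t c A B ∨ t * (A₁.card + B.card) ≤ NS t A₁ B + c ∨ ∀ w ∈ A₁ + B, t ≤ rep A₁ B w := by
  rcases ih A₁ B (meas_lt_of_NS_lt hNS) hA₁t (by omega) with hP | ⟨A', B', hS⟩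
  · exact Or.inr (Or.inl hP)
  obtain ⟨hA'ne, hB'ne⟩ := hS.nonempty hA₁t (by omega)
  obtain ⟨A'', B'', hS2, hsum, hsubA, hsubB, hsA, hsB⟩ := hS.saturate hA'ne hB'ne
  rw [← hsum] at hsA hsB
  have hA''ne : A''.Nonempty := hA'ne.mono hsubA
  have hB''ne : B''.Nonempty := hB'ne.mono hsubB
  have hA''A₁ : A'' ⊆ A₁ := hS2.1
  have hB''B : B'' ⊆ B := hS2.2.1
  have hl := hS2.2.2.1
  have hpop := hS2.2.2.2.1
  rcases step_one hS2 hA''ne hB''ne hsA hsB with h1 | ⟨htight, hHρ, -⟩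
  · exact Or.inr (Or.inl (h1.trans (by omega)))
  set H := (A'' + B'').addStab with hH
  by_cases hdelA : A'' = A₁
  · by_cases hdelB : B'' = B
    · right; right
      intro w hw
      rw [← hdelA, ← hdelB] at hw ⊢
      exact hpop w hw
    · -- some `b ∈ B \ B''`: its row has ≥ t + 1 unpopular sums
      left
      obtain ⟨b, hb, hbB''⟩ := exists_of_ssubset (hB''B.ssubset_of_ne hdelB)
      have hbH : b ∉ B'' + H := fun h => hbB'' (hsB b hb h)
      have hge := card_filter_add_not_mem_ge_right hA''ne hB''ne htight hbH
      rw [← hH] at hge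
      refine goal_of_row ht hc ih hA hB hb (le_trans (by omega) (card_le_card (fun a ha => ?_) :
        (A''.filter (fun a => a + b ∉ A'' + B'')).card ≤ _))
      rw [mem_filter] at ha ⊢
      refine ⟨hA₁A (hA''A₁ ha.1), ?_⟩
      rw [hsep _ (add_mem_add (hA''A₁ ha.1) hb)]
      exact (rep_le_card_sdiff_add (A := A₁) (B := B) ha.2).trans (by omega)
  · -- some `a ∈ A₁ \ A''`: its column has ≥ t + 1 unpopular sums
    left
    obtain ⟨a, ha, haA''⟩ := exists_of_ssubset (hA''A₁.ssubset_of_ne hdelA)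
    have haH : a ∉ A'' + H := fun h => haA'' (hsA a ha h)
    have hge := card_filter_add_not_mem_ge_left hA''ne hB''ne htight haH
    rw [← hH] at hge
    refine goal_of_col ht hc ih hA hB (hA₁A ha) (le_trans (by omega) (card_le_card (fun b hb => ?_) :
      (B''.filter (fun b => a + b ∉ A'' + B'')).card ≤ _))
    rw [mem_filter] at hb ⊢
    refine ⟨hB''B hb.1, ?_⟩
    rw [hsep _ (add_mem_add ha (hB''B hb.1))]
    exact (rep_le_card_sdiff_add (A := A₁) (B := B) hb.2).trans (by omega)

/-- Two separated pieces: if `A = A₁ ⊔ A₂` with `A₁ + B` and `A₂ + B` disjoint (both pieces nonempty), then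
`Goal t c A B`. [cite: Grynkiewicz2010, §2 Case 3.2] -/
theorem goal_of_separated (ht : 1 ≤ t) (hc : t * t ≤ c) (ih : IH t c A B) (hA : t + 1 ≤ A.card)
    (hB : t + 1 ≤ B.card) {A₁ A₂ : Finset G} (hU : A₁ ∪ A₂ = A) (hd : Disjoint A₁ A₂)
    (hs : Disjoint (A₁ + B) (A₂ + B)) (h1 : A₁.Nonempty) (h2 : A₂.Nonempty) : Goal t c A B := by
  have hBne : B.Nonempty := card_pos.1 (by omega)
  have hBt : t ≤ B.card := by omega
  have hA₁A : A₁ ⊆ A := hU ▸ subset_union_left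
  have hA₂A : A₂ ⊆ A := hU ▸ subset_union_right
  have hcard : A.card = A₁.card + A₂.card := by rw [← hU, card_union_of_disjoint hd]
  have hsep₁ : ∀ w ∈ A₁ + B, rep A B w = rep A₁ B w := fun w hw => by
    rw [← hU, rep_union_left hd, rep_eq_zero_of_not_mem (disjoint_left.1 hs hw), add_zero]
  have hsep₂ : ∀ w ∈ A₂ + B, rep A B w = rep A₂ B w := fun w hw => by
    rw [← hU, rep_union_left hd, rep_eq_zero_of_not_mem (disjoint_right.1 hs hw), zero_add]
  have hNS : NS t A B = NS t A₁ B + NS t A₂ B := by rw [← hU]; exact NS_union_of_separated hd hs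
  -- a small piece gives an unpopular column
  by_cases hA₁t : t ≤ A₁.card
  swap
  · obtain ⟨a, ha⟩ := h1
    refine goal_of_col ht hc ih hA hB (hA₁A ha) (le_trans (by omega) (card_le_card (fun b hb => ?_) :
      B.card ≤ _))
    rw [mem_filter]
    refine ⟨hb, ?_⟩
    rw [hsep₁ _ (add_mem_add ha hb)]
    exact (rep_le_card_left A₁ B _).trans (by omega)
  by_cases hA₂t : t ≤ A₂.card
  swap
  · obtain ⟨a, ha⟩ := h2
    refine goal_of_col ht hc ih hA hB (hA₂A ha) (le_trans (by omega) (card_le_card (fun b hb => ?_) :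
      B.card ≤ _))
    rw [mem_filter]
    refine ⟨hb, ?_⟩
    rw [hsep₂ _ (add_mem_add ha hb)]
    exact (rep_le_card_left A₂ B _).trans (by omega)
  -- both pieces are large: induction on each
  have hNS₁pos : 1 ≤ NS t A₁ B := le_trans (card_pos.2 (h1.add hBne)) (card_add_le_NS ht A₁ B)
  have hNS₂pos : 1 ≤ NS t A₂ B := le_trans (card_pos.2 (h2.add hBne)) (card_add_le_NS ht A₂ B)
  have hlt₁ : NS t A₁ B < NS t A B := by omega
  have hlt₂ : NS t A₂ B < NS t A B := by omega
  have hlow₁ := mul_card_le_NS A₁ hBt (t := t)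
  have hlow₂ := mul_card_le_NS A₂ hBt (t := t)
  have e : t * (A.card + B.card) = t * (A₁.card + B.card) + t * A₂.card := by rw [hcard]; ring
  have e' : t * (A.card + B.card) = t * (A₂.card + B.card) + t * A₁.card := by rw [hcard]; ring
  rcases goal_or_of_piece ht hc ih hA hB hA₁A hA₁t hlt₁ hsep₁ with hG | hP | hpop₁
  · exact hG
  · left; rw [e]; omega
  rcases goal_or_of_piece ht hc ih hA hB hA₂A hA₂t hlt₂ hsep₂ with hG | hP | hpop₂
  · exact hG
  · left; rw [e']; omega
  · right
    refine ⟨A, B, Str.of_popular ht fun w hw => ?_⟩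
    rw [← hU, union_add, mem_union] at hw
    rcases hw with hw | hw
    · rw [hsep₁ w hw]; exact hpop₁ w hw
    · rw [hsep₂ w hw]; exact hpop₂ w hw

/-- **The coset trap** ([Gry10] §2 Case 3.2): if `B` lies in one coset of a finite subgroup `K = stab(S)`
while `A` does not lie in one `K`-coset, then `Goal t c A B` (given the induction hypothesis, `t² ≤ c`,
`|A|, |B| ≥ t + 1`). [cite: Grynkiewicz2010, §2 Case 3.2] -/
theorem goal_of_subset_coset (ht : 1 ≤ t) (hc : t * t ≤ c) (ih : IH t c A B) (hA : t + 1 ≤ A.card)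
    (hB : t + 1 ≤ B.card) {S : Finset G} {b₀ : G} (hBc : B ⊆ b₀ +ᵥ S.addStab)
    (hAc : ∀ a₀ ∈ A, ¬ A ⊆ a₀ +ᵥ S.addStab) : Goal t c A B := by
  have hAne : A.Nonempty := card_pos.1 (by omega)
  obtain ⟨a₀, ha₀⟩ := hAne
  have hSne : S.Nonempty := by
    have hBne : B.Nonempty := card_pos.1 (by omega)
    obtain ⟨b, hb⟩ := hBne
    obtain ⟨k, hk, -⟩ := mem_vadd_finset.1 (hBc hb)
    exact Nonempty.of_addStab ⟨k, hk⟩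
  refine goal_of_separated ht hc ih hA hB (A₁ := A ∩ (a₀ +ᵥ S.addStab)) (A₂ := A \ (a₀ +ᵥ S.addStab))
    (by ext a; simp only [mem_union, mem_inter, mem_sdiff]; tauto) (disjoint_sdiff_inter A _).symm ?_
    ⟨a₀, mem_inter.2 ⟨ha₀, mem_coset_self hSne a₀⟩⟩ ?_
  · -- the two sumsets lie in different `K`-cosets
    rw [disjoint_left]
    rintro w hw hw'
    obtain ⟨a₁, ha₁, b₁, hb₁, rfl⟩ := mem_add.1 hw
    obtain ⟨a₂, ha₂, b₂, hb₂, he⟩ := mem_add.1 hw'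
    rw [mem_inter, mem_coset_iff] at ha₁
    rw [mem_sdiff, mem_coset_iff] at ha₂
    have hb₁' := mem_coset_iff.1 (hBc hb₁)
    have hb₂' := mem_coset_iff.1 (hBc hb₂)
    apply ha₂.2
    have : a₂ - a₀ = (a₁ - a₀) + (b₁ - b₀) - (b₂ - b₀) := by
      have : a₂ = a₁ + b₁ - b₂ := by rw [← he]; abel
      rw [this]; abel
    rw [this]
    exact sub_mem_addStab (add_mem_addStab ha₁.2 hb₁') hb₂'
  · obtain ⟨a, ha, haK⟩ := not_subset.1 (hAc a₀ ha₀)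
    exact ⟨a, mem_sdiff.2 ⟨ha, haK⟩⟩

end Separation

/-! ### The additive-energy identities (for [Gry10] Lemma 2.1) -/

section Energy

variable {A B : Finset G}

/-- `Σ_{w ∈ A + B} r_{A,B}(w)² = #{(p,q) ∈ (A × B)² : p₁ + p₂ = q₁ + q₂}` (the additive energy).
[cite: Grynkiewicz2010, Lemma 2.1] -/
theorem sum_rep_sq_eq_card :
    ∑ w ∈ A + B, rep A B w ^ 2 =
      (((A ×ˢ B) ×ˢ (A ×ˢ B)).filter (fun pq => pq.1.1 + pq.1.2 = pq.2.1 + pq.2.2)).card := by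
  rw [card_eq_sum_card_fiberwise (f := fun pq : (G × G) × (G × G) => pq.1.1 + pq.1.2) (t := A + B)
    (s := ((A ×ˢ B) ×ˢ (A ×ˢ B)).filter (fun pq => pq.1.1 + pq.1.2 = pq.2.1 + pq.2.2))]
  · refine sum_congr rfl fun w _ => ?_
    rw [sq, rep_def, ← card_product, ← filter_product, filter_filter]
    congr 1
    refine filter_congr fun pq _ => ?_
    constructor
    · rintro ⟨hw, hw'⟩; exact ⟨by rw [hw, hw'], hw⟩
    · rintro ⟨he, hw⟩; exact ⟨hw, by rw [← he]; exact hw⟩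
  · intro pq hpq
    have h := mem_filter.1 (mem_coe.1 hpq)
    exact mem_coe.2 (add_mem_add (mem_product.1 (mem_product.1 h.1).1).1 (mem_product.1 (mem_product.1 h.1).1).2)

/-- `Σ_{z ∈ A − B} |A ∩ (z + B)|² = #{(p,q) ∈ (A × B)² : p₁ + p₂ = q₁ + q₂}` (count the same quadruples
through `z = p₁ − q₂ = q₁ − p₂`). [cite: Grynkiewicz2010, Lemma 2.1] -/
theorem sum_card_inter_vadd_sq_eq_card :
    ∑ z ∈ A - B, (A ∩ (z +ᵥ B)).card ^ 2 =
      (((A ×ˢ B) ×ˢ (A ×ˢ B)).filter (fun pq => pq.1.1 + pq.1.2 = pq.2.1 + pq.2.2)).card := by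
  rw [card_eq_sum_card_fiberwise (f := fun pq : (G × G) × (G × G) => pq.1.1 - pq.2.2) (t := A - B)
    (s := ((A ×ˢ B) ×ˢ (A ×ˢ B)).filter (fun pq => pq.1.1 + pq.1.2 = pq.2.1 + pq.2.2))]
  · refine sum_congr rfl fun z _ => ?_
    rw [sq, ← card_product]
    symm
    refine card_nbij' (fun pq => (pq.1.1, pq.2.1)) (fun aa => ((aa.1, aa.2 - z), (aa.2, aa.1 - z)))
      ?_ ?_ ?_ ?_
    · rintro ⟨⟨a, b⟩, ⟨a', b'⟩⟩ h
      simp only [mem_coe, mem_filter, mem_product] at h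
      obtain ⟨⟨⟨⟨ha, hb⟩, ha', hb'⟩, he⟩, hz⟩ := h
      have e1 : a - z = b' := by rw [← hz, sub_sub_cancel]
      have e2 : a' - z = b := by rw [eq_sub_of_add_eq he.symm, ← hz]; abel
      simp only [mem_coe, mem_product, mem_inter_vadd_iff]
      exact ⟨⟨ha, by rw [e1]; exact hb'⟩, ha', by rw [e2]; exact hb⟩
    · rintro ⟨a, a'⟩ h
      simp only [mem_coe, mem_product, mem_inter_vadd_iff] at h
      obtain ⟨⟨ha, hb'⟩, ha', hb⟩ := h
      simp only [mem_coe, mem_filter, mem_product]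
      exact ⟨⟨⟨⟨ha, hb⟩, ha', hb'⟩, by abel⟩, by abel⟩
    · rintro ⟨⟨a, b⟩, ⟨a', b'⟩⟩ h
      simp only [mem_coe, mem_filter, mem_product] at h
      obtain ⟨⟨-, he⟩, hz⟩ := h
      have e1 : a - z = b' := by rw [← hz, sub_sub_cancel]
      have e2 : a' - z = b := by rw [eq_sub_of_add_eq he.symm, ← hz]; abel
      show ((a, a' - z), (a', a - z)) = ((a, b), (a', b'))
      rw [e1, e2]
    · rintro ⟨a, a'⟩ _
      rfl
  · intro pq hpq
    have h := mem_filter.1 (mem_coe.1 hpq)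
    exact mem_coe.2 (sub_mem_sub (mem_product.1 (mem_product.1 h.1).1).1 (mem_product.1 (mem_product.1 h.1).2).2)

/-- The energy symmetry `Σ_{w ∈ A + B} r_{A,B}(w)² = Σ_{z ∈ A − B} |A ∩ (z + B)|²`. [cite: Grynkiewicz2010, Lemma 2.1] -/
theorem sum_rep_sq_eq_sum_card_inter_vadd_sq :
    ∑ w ∈ A + B, rep A B w ^ 2 = ∑ z ∈ A - B, (A ∩ (z +ᵥ B)).card ^ 2 := by
  rw [sum_rep_sq_eq_card, sum_card_inter_vadd_sq_eq_card]

/-- `Σ_{z ∈ A − B} |A ∩ (z + B)| = |A||B|`. [cite: Grynkiewicz2010, Lemma 2.1] -/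
theorem sum_card_inter_vadd : ∑ z ∈ A - B, (A ∩ (z +ᵥ B)).card = A.card * B.card := by
  rw [← card_product, card_eq_sum_card_fiberwise (f := fun p : G × G => p.1 - p.2) (t := A - B)
    (s := A ×ˢ B)]
  · refine sum_congr rfl fun z _ => ?_
    refine card_nbij' (fun a => (a, a - z)) (fun p => p.1) ?_ ?_ ?_ ?_
    · intro a ha
      rw [mem_coe, mem_inter_vadd_iff] at ha
      simp only [mem_coe, mem_filter, mem_product]
      exact ⟨⟨ha.1, ha.2⟩, by abel⟩
    · rintro ⟨a, b⟩ h
      simp only [mem_coe, mem_filter, mem_product] at h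
      rw [mem_coe, mem_inter_vadd_iff]
      exact ⟨h.1.1, by rw [← h.2]; simpa using h.1.2⟩
    · intro a _; rfl
    · rintro ⟨a, b⟩ h
      simp only [mem_coe, mem_filter, mem_product] at h
      simp only [Prod.mk.injEq]
      exact ⟨trivial, by rw [← h.2]; abel⟩
  · intro p hp
    exact mem_coe.2 (sub_mem_sub (mem_product.1 (mem_coe.1 hp)).1 (mem_product.1 (mem_coe.1 hp)).2)

end Energy

end Grynkiewicz

end Literature.Combinatorics.Additive
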